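import Summits.NavierStokesRegularity.NavierStokesRegularity.Theorems.EulerZoomLiouvillePowerGaugeEulerLiouvilleNeedleGradientGrowthTools
import HarnessLib

/-!
# Crux E `PowerGaugeEulerLiouville` (stmt-NavierStokesRegularity-19832) — SCALE-OSCILLATION TAMENESS, file 2/2: THE TWO INSTANCES

Route №10 `EulerZoomLiouville` (NavierStokesRegularity), crux E, THE ONE STATEMENT `stub_selfSimilarC2Needle`; third lane of
ns-ezl-w1 g2.  File 1/2 `…NeedleOscillationTame.lean` proves that a `C¹` profile with the class gauges and the oscillation bound
(Osc) `‖V y' − V y‖ ≤ m‖y‖` for `‖y' − y‖ ≤ K‖y‖^{1−q}`, `‖y‖ ≥ R₀` (`q < 2+ρ`) has no fast radial inflow far out.  THIS FILE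
records that the two previously separate tame strata are instances of (Osc):

* `oscTame_of_uniformContinuous` — `UniformContinuous V` ⇒ (Osc) with `q = 1` (any `m > 0`);
* `oscTame_of_polyGradient` — `‖∇V(y)‖ ≤ K(1+‖y‖)^q` ⇒ (Osc) at the scale `‖y‖^{1−max q 0}` (any `m > 0`; mean-value inequality
  with the envelope `NeedleGradientGrowth.aux_envelope_le`).

WHAT THIS IS NOT: not NS, not E — bookkeeping; 19832 OPEN.  [folklore]
-/

noncomputable section

set_option linter.dupNamespace false

open MeasureTheory Set Filter Topology Metric Function Real
open scoped RealInnerProductSpace ENNReal NNReal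

namespace Summit.NavierStokesRegularity.NavierStokesRegularity.Theorems.PowerGaugeEulerLiouville.NeedleOscillationTame

open NeedleGradientGrowth

/-! ## The two instances: uniform continuity, polynomial gradient growth -/

/-- `UniformContinuous V` ⇒ (Osc) with `q = 1`: for every `m > 0` there are `K > 0`, `R₀` with `‖V y' − V y‖ ≤ m‖y‖` whenever
`‖y' − y‖ ≤ K‖y‖^{1−1}` and `‖y‖ ≥ R₀`. [folklore] -/
theorem oscTame_of_uniformContinuous {V : EuclideanSpace ℝ (Fin 3) → EuclideanSpace ℝ (Fin 3)} (hV : UniformContinuous V)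
    {m : ℝ} (hm : 0 < m) :
    ∃ K R₀ : ℝ, 0 < K ∧ ∀ y : EuclideanSpace ℝ (Fin 3), R₀ ≤ ‖y‖ → ∀ y' : EuclideanSpace ℝ (Fin 3),
      ‖y' - y‖ ≤ K * ‖y‖ ^ (1 - (1 : ℝ)) → ‖V y' - V y‖ ≤ m * ‖y‖ := by
  obtain ⟨δ, hδ, hδV⟩ := Metric.uniformContinuous_iff.1 hV 1 one_pos
  refine ⟨δ / 2, 1 / m, by positivity, fun y hy y' hy' => ?_⟩
  rw [sub_self, Real.rpow_zero, mul_one] at hy'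
  have hd : dist y' y < δ := by rw [dist_eq_norm]; linarith
  have h1 : ‖V y' - V y‖ < 1 := by rw [← dist_eq_norm]; exact hδV hd
  have h2 : 1 ≤ m * ‖y‖ := by
    rw [div_le_iff₀ hm] at hy
    linarith
  linarith

/-- Polynomial gradient growth `‖∇V(y)‖ ≤ K(1+‖y‖)^q` ⇒ (Osc) at the scale `‖y‖^{1−max q 0}`: for every `m > 0` there is
`K' > 0` with `‖V y' − V y‖ ≤ m‖y‖` whenever `‖y' − y‖ ≤ K'‖y‖^{1−max q 0}` and `‖y‖ ≥ 1` (mean-value inequality on the closed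
ball with the envelope `Kp(1+2‖y‖)^{max q 0} ≤ (Kp 3^{max q 0} + 2m)‖y‖^{max q 0}`, `aux_envelope_le`). [folklore] -/
theorem oscTame_of_polyGradient {V : EuclideanSpace ℝ (Fin 3) → EuclideanSpace ℝ (Fin 3)} (hVd : Differentiable ℝ V)
    {K q : ℝ} (hgrad : ∀ y, ‖fderiv ℝ V y‖ ≤ K * (1 + ‖y‖) ^ q) {m : ℝ} (hm : 0 < m) :
    ∃ K' R₀ : ℝ, 0 < K' ∧ ∀ y : EuclideanSpace ℝ (Fin 3), R₀ ≤ ‖y‖ → ∀ y' : EuclideanSpace ℝ (Fin 3),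
      ‖y' - y‖ ≤ K' * ‖y‖ ^ (1 - max q 0) → ‖V y' - V y‖ ≤ m * ‖y‖ := by
  obtain ⟨Kp, hKp⟩ : ∃ Kp : ℝ, Kp = max K 0 := ⟨_, rfl⟩
  have hKp0 : 0 ≤ Kp := by rw [hKp]; exact le_max_right _ _
  have hKKp : K ≤ Kp := by rw [hKp]; exact le_max_left _ _
  obtain ⟨q', hq'⟩ : ∃ q' : ℝ, q' = max q 0 := ⟨_, rfl⟩
  have hq'0 : 0 ≤ q' := by rw [hq']; exact le_max_right _ _
  have hqq' : q ≤ q' := by rw [hq']; exact le_max_left _ _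
  obtain ⟨M, hM⟩ : ∃ M : ℝ, M = Kp * 3 ^ q' + 2 * m := ⟨_, rfl⟩
  have hM0 : 0 < M := by rw [hM]; positivity
  have hMm : 2 * m ≤ M := by rw [hM]; exact le_add_of_nonneg_left (by positivity)
  refine ⟨m / (2 * M), 1, by positivity, fun y hy y' hy' => ?_⟩
  rw [← hq'] at hy'
  have hs0 : 0 < ‖y‖ := by linarith
  have hsq : 0 < ‖y‖ ^ (1 - q') := Real.rpow_pos_of_pos hs0 _
  -- the radius `ρ' = (m/(2M)) ‖y‖^{1−q'}` is at most `‖y‖/4`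
  have hK'4 : m / (2 * M) ≤ 1 / 4 := by
    rw [div_le_iff₀ (by positivity)]
    linarith only [hMm]
  have hρ's : m / (2 * M) * ‖y‖ ^ (1 - q') ≤ ‖y‖ / 4 := by
    have h1 : ‖y‖ ^ (1 - q') ≤ ‖y‖ ^ (1 : ℝ) := Real.rpow_le_rpow_of_exponent_le hy (by linarith)
    rw [Real.rpow_one] at h1
    calc m / (2 * M) * ‖y‖ ^ (1 - q') ≤ 1 / 4 * ‖y‖ := mul_le_mul hK'4 h1 hsq.le (by norm_num)
      _ = ‖y‖ / 4 := by ring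
  -- gradient envelope on the closed ball
  have hbound : ∀ x ∈ closedBall y (m / (2 * M) * ‖y‖ ^ (1 - q')), ‖fderiv ℝ V x‖ ≤ Kp * (1 + 2 * ‖y‖) ^ q' := by
    intro x hx
    rw [mem_closedBall, dist_eq_norm] at hx
    have hn : ‖x‖ ≤ 2 * ‖y‖ := by
      have h' : ‖x‖ ≤ ‖y‖ + ‖x - y‖ := by
        calc ‖x‖ = ‖y + (x - y)‖ := by rw [add_sub_cancel]
          _ ≤ ‖y‖ + ‖x - y‖ := norm_add_le _ _
      linarith only [h', hx, hρ's, hs0]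
    have h1 : ‖fderiv ℝ V x‖ ≤ Kp * (1 + ‖x‖) ^ q :=
      (hgrad x).trans (mul_le_mul_of_nonneg_right hKKp (by positivity))
    have h2 : (1 + ‖x‖) ^ q ≤ (1 + ‖x‖) ^ q' :=
      Real.rpow_le_rpow_of_exponent_le (by linarith [norm_nonneg x]) hqq'
    have h3 : (1 + ‖x‖) ^ q' ≤ (1 + 2 * ‖y‖) ^ q' := Real.rpow_le_rpow (by positivity) (by linarith) hq'0
    exact h1.trans (mul_le_mul_of_nonneg_left (h2.trans h3) hKp0)
  have hmvt : ‖V y' - V y‖ ≤ Kp * (1 + 2 * ‖y‖) ^ q' * ‖y' - y‖ :=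
    (convex_closedBall y _).norm_image_sub_le_of_norm_fderiv_le (fun x _ => hVd.differentiableAt) hbound
      (mem_closedBall_self (by positivity)) (by rw [mem_closedBall, dist_eq_norm]; exact hy')
  -- envelope `Kp (1+2s)^{q'} ≤ M s^{q'}`
  have henv : Kp * (1 + 2 * ‖y‖) ^ q' ≤ M * ‖y‖ ^ q' := by
    have h := aux_envelope_le (Kp := Kp) (q' := q') (κ := m) hy hKp0 hq'0 hm.le
    rw [hM]
    have : 0 ≤ 2 * m * ‖y‖ ^ q' := by positivity
    nlinarith only [h, this, Real.rpow_pos_of_pos hs0 q']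
  have hsplit : ‖y‖ ^ q' * ‖y‖ ^ (1 - q') = ‖y‖ := by
    rw [← Real.rpow_add hs0]
    norm_num
  have hG0 : 0 ≤ Kp * (1 + 2 * ‖y‖) ^ q' := by positivity
  calc ‖V y' - V y‖ ≤ Kp * (1 + 2 * ‖y‖) ^ q' * ‖y' - y‖ := hmvt
    _ ≤ (M * ‖y‖ ^ q') * (m / (2 * M) * ‖y‖ ^ (1 - q')) :=
        mul_le_mul henv hy' (norm_nonneg _) (by positivity)
    _ = m / 2 * (‖y‖ ^ q' * ‖y‖ ^ (1 - q')) := by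
        field_simp
    _ = m / 2 * ‖y‖ := by rw [hsplit]
    _ ≤ m * ‖y‖ := by linarith only [mul_pos hm hs0]

end Summit.NavierStokesRegularity.NavierStokesRegularity.Theorems.PowerGaugeEulerLiouville.NeedleOscillationTame

end
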